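import Literature.AnabelianGeometry.EtaleTheta.Discharge.Sec5Thm57JunctionHK4OfK4
import Literature.AnabelianGeometry.EtaleTheta.Thm56SubdagStatementsGalois

/-!
# [EtTh] §5, Theorem 5.7 (C)-junction `hK4` ⟸ the Thm. 5.6 package — RE-KEYED ON THE v2 SUBQUOTIENT RECORD
# `ThetaSubquotientProjGalois 𝔉 Gal` (surjectivity at Galois objects only) — PROOF-ONLY, proofs verbatim

Mochizuki, *The étale theta function and its Frobenioid-theoretic manifestations*, Publ. RIMS **45** (2009)
[cite: MochizukiEtTh2009, Thm 5.7 proof p.330 (PDF p.104); Thm 5.6 p.328–329 (PDF pp.102–103); Prop 5.5 p.327 (PDF p.101);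
Prop 5.2 (iii) p.324 (PDF p.98); §5 p.327 (PDF p.101) «these subquotients determine subquotients `Aut_D(D) ↠ Aut^Θ_D(D)`»].
abc-iut cell, layer L2, seat abc-iut-w5-d051 (gen 6), row «(w4) V1→V2 MECHANICAL PORT — TRANCHE 2 = THM 5.7 (C)-JUNCTION HEADS»
(abc-iut-L2-lead gen 7, VNEXT-CENSUS-L2 §G5 add. 11 standing row «(w4)», «load-bearing heads first (the junction's)»).

WHY.  abc-iut-L2-t9's `Discharge/Sec5Thm57JunctionHK4OfK4.lean` (the file imported above) proves the Thm. 5.7 (C)-junction — the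
consumer binder `hK4 : Ψ^Aut_β (m⁻¹ x) = m⁻¹ (γ_Δ x)` of abc-iut-L2-d4's `kummerComparison_of_thetaSectionCompat` FROM the pin
(Prop. 5.2 (iii)), Prop. 5.5 at `B_N`, coverage, T56-L09c and (K4β) — over a binder `{P : ThetaSubquotientProj 𝔉}`, abc-iut-L2-t4's v1
record, whose field `proj_surjective` asks `P_E ↠ (l·Δ_Θ)_E` at EVERY object `E` of the base.  That record is EMPTY at the cell's root
model for `l` odd (abc-iut-L2-t9 p456572 `…EmptyOfRigidObject`, kernel certificate p476337 `…EmptyAtRootModel`: rigid NON-Galois objects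
obstruct), so there every one of those twelve theorems quantifies over an empty type.  abc-iut-w6-d079's v2 record
`FrobenioidCyclotomicRigidity.ThetaSubquotientProjGalois 𝔉 Gal` (p481123; `proj_surjective` only at the objects singled out by
`Gal : D → Prop`, as print uses it — Prop. 5.1 / Lemma 5.9 run over connected GALOIS coverings) is INHABITED at every `ofSetting` carrier
including the root model (p481568) and at abc-iut-L2-t4's junction object `ofThetaSettingDataQ` (p485626), and carries the v2 clauses
`ThetaSubquotientProjGalois.IsKummerDetermined` (p481123), `Thm56Sub.LDeltaCoveredGal` / `Thm56Sub.DeltaTransportCompatGal` (p484491) —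
the SAME formulas (they read `P` only through `pre` / `proj` at `Base(B_N)`; `…_toGalois_iff : Iff.rfl`).

THIS FILE re-keys the twelve `P`-binding theorems of `Sec5Thm57JunctionHK4OfK4` on the v2 record: binder
`{Gal : D → Prop} {P : ThetaSubquotientProjGalois 𝔉 Gal}`, hypotheses `hKD : P.IsKummerDetermined ρ hB`,
`hcov : Thm56Sub.LDeltaCoveredGal 𝔉 P`, `hΔ : Thm56Sub.DeltaTransportCompatGal 𝔉 Ψ β aΨ θ P`; statements otherwise and proofs VERBATIM
(abc-iut-L2-t9's arguments never use `proj_surjective`); names = the originals with suffix `_galois`.  The two `P`-free theorems of the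
source (`psiAut_symm_eq_of_junction`, `psiAut_symm_eq_conj`) and the `P`-free producers consumed (abc-iut-L2-d4's
`kummerComparison_of_thetaSectionCompat` p453757, abc-iut-w5-d034's `Thm56Sub.psiAut_rigidity_eq_rigidity_transport_of_preserved`
p449783) are used BY NAME, not restated.  Last section: the v1 heads ARE the `toGalois` instances of the v2 heads (bookkeeping check on the
main head, `Gal` arbitrary).  0 `def`s, nothing landed is edited.

RESULT.  The (C)-junction of Thm. 5.7 — `hK4` ⟸ {pin, `IsKummerDetermined`, `LDeltaCoveredGal`, `DeltaTransportCompatGal`, (K4β)}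
(`psiAut_symm_eq_of_rigidity_galois`), existence and uniqueness of the junction's `γ_Δ` (`exists_gammaDelta_of_rigidity_galois`,
`gammaDelta_unique_galois`, `gammaDelta_eq_conj_of_eta_galois`), and abc-iut-L2-d4's `HC` with `hK4` replaced by the Thm. 5.6 package
(`kummerComparison_of_thetaSectionCompat_of_rigidity_galois` / `…_of_preserved_galois`) — now stated over a record that has TERMS at the
carriers of record.  Which of the remaining named inputs hold at a given v2 term is NOT asserted here (abc-iut-w6-d079's (w4) tranche 1
discharges the pins at the junction object; coverage / T56-L09c stay displayed).
HONEST FRAMING: a typing repair of the cell's OWN record (weaker quantifier, as print uses it); kernel-checked implications between typed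
statements over an ABSTRACT §5 datum `𝔉`; nothing of [EtTh] (a refereed paper) is asserted; typed ≠ discharged; nothing here bears on
[IUTchIII] Cor. 3.12 — no side taken; nothing here asserts abc proved or refuted.
-/

namespace Literature.AnabelianGeometry.EtaleTheta

open CategoryTheory FrobenioidCyclotomicRigidity

universe w v v' u u'

namespace ThetaFrobenioid

variable {C : Type u} [Category.{v} C] {D : Type u'} [Category.{v'} D] {𝔉 : ThetaFrobenioid.{w} C D} {Gal : D → Prop}

/-! ### (2) (J1) PROVED pointwise on the theta classes of the Δ-part: the pin + Prop. 5.5 at `B_N` — on the v2 record -/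

/-- **(J1) on the Δ-part** — «in light of the crucial isomorphisms of Prop. 5.5»: under the pin `ThetaSectionCompat` (Prop. 5.2 (iii):
`m(d(k)) = η(ι k)⁻¹` for the bi-Kummer difference `d`) and `IsKummerDetermined P ρ hB` (Prop. 5.5: `ρ_{B_N}[P.proj h] = s^⊓-gp_N(h)·s^⊔-gp_N(h)⁻¹`
on the part `P.pre` of `H_{B_N}`), for every `k ∈ Π^tp_Ÿ` with `ρ k ∈ P.pre`:  `m⁻¹(η(ι k)) = ρ_{B_N} [P.proj (ρ k)]` in `Aut_C(B_N)`.
[cite: MochizukiEtTh2009, Prop 5.5 p.327 (PDF p.101); Prop 5.2 (iii) p.324 (PDF p.98); Thm 5.7 proof p.330 (PDF p.104)] -/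
theorem coe_symm_eta_eq_rigidity_galois (H : 𝔉.Facts) (T : ThetaEnvData.{v} 𝔉.N) (ι : 𝔉.PiX ≃* T.PiX)
    (m : 𝔉.muTorsion 𝔉.BN 𝔉.N ≃* T.mu) (hι : 𝔉.IdentifiesPiYdd T ι) {η : T.PiYdd → T.mu}
    (hpin : 𝔉.ThetaSectionCompat H T ι m hι η) {P : ThetaSubquotientProjGalois 𝔉 Gal} {ρ : RigidityFamily 𝔉}
    {hB : 𝔉.IsThetaSaturated 𝔉.BN} (hKD : P.IsKummerDetermined ρ hB) (k : 𝔉.PiYdd)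
    (hk : 𝔉.ρ k ∈ P.pre (𝔉.base.obj 𝔉.BN)) :
    ((m.symm (η ⟨ι k, (hι k).mp k.2⟩) : 𝔉.muTorsion 𝔉.BN 𝔉.N) : Aut 𝔉.BN) =
      (ρ 𝔉.BN hB (QuotientGroup.mk (P.proj _ ⟨𝔉.ρ k, hk⟩)) : Aut 𝔉.BN) := by
  rw [← 𝔉.sgpCap_mul_sgpCup_inv_eq_of_thetaSectionCompat H T ι m hι hpin k]
  exact (hKD ⟨𝔉.ρ k, Subgroup.mem_map_of_mem _ k.2⟩ hk).symm

/-- (J1) on the Δ-part, valued in `μ_N(B_N)`: `m⁻¹(η(ι k)) = ρ_{B_N} [P.proj (ρ k)]`.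
[cite: MochizukiEtTh2009, Prop 5.5 p.327 (PDF p.101); Prop 5.2 (iii) p.324 (PDF p.98)] -/
theorem symm_eta_eq_rigidity_galois (H : 𝔉.Facts) (T : ThetaEnvData.{v} 𝔉.N) (ι : 𝔉.PiX ≃* T.PiX)
    (m : 𝔉.muTorsion 𝔉.BN 𝔉.N ≃* T.mu) (hι : 𝔉.IdentifiesPiYdd T ι) {η : T.PiYdd → T.mu}
    (hpin : 𝔉.ThetaSectionCompat H T ι m hι η) {P : ThetaSubquotientProjGalois 𝔉 Gal} {ρ : RigidityFamily 𝔉}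
    {hB : 𝔉.IsThetaSaturated 𝔉.BN} (hKD : P.IsKummerDetermined ρ hB) (k : 𝔉.PiYdd)
    (hk : 𝔉.ρ k ∈ P.pre (𝔉.base.obj 𝔉.BN)) :
    m.symm (η ⟨ι k, (hι k).mp k.2⟩) = ρ 𝔉.BN hB (QuotientGroup.mk (P.proj _ ⟨𝔉.ρ k, hk⟩)) :=
  Subtype.ext (coe_symm_eta_eq_rigidity_galois H T ι m hι hpin hKD k hk)

/-- (J1) on the Δ-part in the shape of the K4 knits' normalisation binder `hme` (abc-iut-w4-d099 / p450400: `m ∘ ν ∘ e = id`):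
`m (ρ_{B_N} [P.proj (ρ k)]) = η(ι k)` — with `RigidData.cocycle_lDeltaTheta` (`η = thetaMod` on `l·Δ_Θ`) this IS `hme` at `ν := ρ_{B_N}`.
[cite: MochizukiEtTh2009, Prop 5.5 p.327 (PDF p.101); Prop 5.2 (iii) p.324 (PDF p.98)] -/
theorem m_rigidity_proj_eq_eta_galois (H : 𝔉.Facts) (T : ThetaEnvData.{v} 𝔉.N) (ι : 𝔉.PiX ≃* T.PiX)
    (m : 𝔉.muTorsion 𝔉.BN 𝔉.N ≃* T.mu) (hι : 𝔉.IdentifiesPiYdd T ι) {η : T.PiYdd → T.mu}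
    (hpin : 𝔉.ThetaSectionCompat H T ι m hι η) {P : ThetaSubquotientProjGalois 𝔉 Gal} {ρ : RigidityFamily 𝔉}
    {hB : 𝔉.IsThetaSaturated 𝔉.BN} (hKD : P.IsKummerDetermined ρ hB) (k : 𝔉.PiYdd)
    (hk : 𝔉.ρ k ∈ P.pre (𝔉.base.obj 𝔉.BN)) :
    m (ρ 𝔉.BN hB (QuotientGroup.mk (P.proj _ ⟨𝔉.ρ k, hk⟩))) = η ⟨ι k, (hι k).mp k.2⟩ := by
  rw [← symm_eta_eq_rigidity_galois H T ι m hι hpin hKD k hk, MulEquiv.apply_symm_apply]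

/-- **The theta classes of the Δ-part EXHAUST `μ_N`**: under the pin, `IsKummerDetermined` and `LDeltaCovered P` (the part of `H_{B_N}` over
`(l·Δ_Θ)_{B_N}` maps onto `(l·Δ_Θ)_{B_N} ⊗ ℤ/N`; §1 p.238: `l·Δ_Θ ⊆ Π^tp_Ÿ`), every `x ∈ μ_N` is `η(ι k)` for some `k ∈ Π^tp_Ÿ` with
`ρ k ∈ P.pre` — so (J1) pointwise on the Δ-part is ALL of (J1) «`m⁻¹ = ρ_{B_N} ∘ r`».
[cite: MochizukiEtTh2009, Prop 5.5 proof p.327–328 (PDF pp.101–102); §1 p.238 (PDF p.12)] -/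
theorem exists_eta_iota_eq_of_lDeltaCovered_galois (H : 𝔉.Facts) (T : ThetaEnvData.{v} 𝔉.N) (ι : 𝔉.PiX ≃* T.PiX)
    (m : 𝔉.muTorsion 𝔉.BN 𝔉.N ≃* T.mu) (hι : 𝔉.IdentifiesPiYdd T ι) {η : T.PiYdd → T.mu}
    (hpin : 𝔉.ThetaSectionCompat H T ι m hι η) {P : ThetaSubquotientProjGalois 𝔉 Gal} {ρ : RigidityFamily 𝔉}
    {hB : 𝔉.IsThetaSaturated 𝔉.BN} (hKD : P.IsKummerDetermined ρ hB) (hcov : Thm56Sub.LDeltaCoveredGal 𝔉 P)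
    (x : T.mu) :
    ∃ (k : 𝔉.PiYdd) (_ : 𝔉.ρ k ∈ P.pre (𝔉.base.obj 𝔉.BN)), η ⟨ι k, (hι k).mp k.2⟩ = x := by
  obtain ⟨h, hh, hx⟩ := hcov ((ρ 𝔉.BN hB).symm (m.symm x))
  obtain ⟨k₀, hk₀, hρk⟩ := Subgroup.mem_map.mp h.2
  have hk : 𝔉.ρ ((⟨k₀, hk₀⟩ : 𝔉.PiYdd) : 𝔉.PiX) ∈ P.pre (𝔉.base.obj 𝔉.BN) := by
    change 𝔉.ρ k₀ ∈ P.pre (𝔉.base.obj 𝔉.BN)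
    rw [hρk]
    exact hh
  refine ⟨⟨k₀, hk₀⟩, hk, ?_⟩
  apply m.symm.injective
  apply Subtype.ext
  rw [coe_symm_eta_eq_rigidity_galois H T ι m hι hpin hKD ⟨k₀, hk₀⟩ hk]
  have eh : (⟨𝔉.ρ ((⟨k₀, hk₀⟩ : 𝔉.PiYdd) : 𝔉.PiX), hk⟩ : P.pre (𝔉.base.obj 𝔉.BN)) =
      ⟨(h : Aut (𝔉.base.obj 𝔉.BN)), hh⟩ := Subtype.ext hρk
  rw [eh, hx, MulEquiv.apply_symm_apply]

/-! ### (2′) `hK4` from the Thm. 5.6 package, (J2) in `η`-currency — on the v2 record -/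

/-- **R479: `hK4` OF THE (C)-JUNCTION ⟸ THE THM. 5.6 PACKAGE.**  Inputs: the pin `ThetaSectionCompat` (Prop. 5.2 (iii)); Prop. 5.5 at
`B_N` (`IsKummerDetermined P ρ hB`) and coverage (`LDeltaCovered P`); Thm. 5.6 read through `β` — (K4β) `Ψ^Aut_β(ρ_{B_N} x) =
ρ_{B_N}(((l·Δ_Θ) ⊗ ℤ/N)(β)(aΨ_{B_N} x))` (abc-iut-w5-d034's `psiAut_rigidity_eq_rigidity_transport[_of_preserved]`) and T56-L09c
`DeltaTransportCompat Ψ β aΨ θ P` (on the Δ-part that transport is `[P.proj g] ↦ [P.proj (θ g)]`); the consumer's shadow law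
`θ(ρ k) = ρ(ι⁻¹ γ ι k)`; and (J2η) «`γ_Δ` is `γ` on the theta classes of the Δ-part»: `γ_Δ(η(ι k)) = η(γ(ι k))` whenever `ρ k ∈ P.pre`.
Conclusion: VERBATIM the binder `hK4` of abc-iut-L2-d4's `kummerComparison_of_thetaSectionCompat` (p453757).  Proof: write `x = η(ι k)`
(coverage), then `Ψ^Aut_β(m⁻¹ x) = Ψ^Aut_β(ρ[P.proj ρk]) = ρ[((l·Δ_Θ)⊗ℤ/N)(β) aΨ [P.proj ρk]] = ρ[P.proj θ(ρk)] = ρ[P.proj ρk′] = m⁻¹(η(ι k′))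
= m⁻¹(η(γ ι k)) = m⁻¹(γ_Δ x)` with `k′ := ι⁻¹ γ ι k`.
[cite: MochizukiEtTh2009, Thm 5.7 proof p.330 (PDF p.104); Thm 5.6 p.328–329 (PDF pp.102–103); Prop 5.5 p.327 (PDF p.101)] -/
theorem psiAut_symm_eq_of_rigidity_galois (H : 𝔉.Facts) (T : ThetaEnvData.{v} 𝔉.N) (ι : 𝔉.PiX ≃* T.PiX)
    (m : 𝔉.muTorsion 𝔉.BN 𝔉.N ≃* T.mu) (hι : 𝔉.IdentifiesPiYdd T ι) {η : T.PiYdd → T.mu}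
    (hpin : 𝔉.ThetaSectionCompat H T ι m hι η) {P : ThetaSubquotientProjGalois 𝔉 Gal} {ρ : RigidityFamily 𝔉}
    {hB : 𝔉.IsThetaSaturated 𝔉.BN} (hKD : P.IsKummerDetermined ρ hB) (hcov : Thm56Sub.LDeltaCoveredGal 𝔉 P)
    (Ψ : C ≌ C) (β : Ψ.functor.obj 𝔉.BN ≅ 𝔉.BN)
    (aΨ : ∀ S : C, 𝔉.lDeltaModN S ≃* 𝔉.lDeltaModN (Ψ.functor.obj S))
    (θ : Aut (𝔉.base.obj 𝔉.BN) ≃* Aut (𝔉.base.obj 𝔉.BN)) (hΔ : Thm56Sub.DeltaTransportCompatGal 𝔉 Ψ β aΨ θ P)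
    (hK4β : ∀ x : 𝔉.lDeltaModN 𝔉.BN, 𝔉.psiAut Ψ β (ρ 𝔉.BN hB x : Aut 𝔉.BN) =
      (ρ 𝔉.BN hB (𝔉.lDeltaModNMap β.hom (aΨ 𝔉.BN x)) : Aut 𝔉.BN))
    (γ : T.PiX → T.PiX) (hγ : ∀ x : T.PiX, x ∈ T.PiYdd → γ x ∈ T.PiYdd)
    (hshadow : ∀ k : 𝔉.PiYdd, θ (𝔉.ρ k) = 𝔉.ρ (ι.symm (γ (ι k)))) (γΔ : T.mu → T.mu)
    (hγΔ : ∀ k : 𝔉.PiYdd, 𝔉.ρ k ∈ P.pre (𝔉.base.obj 𝔉.BN) →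
      γΔ (η ⟨ι k, (hι k).mp k.2⟩) = η ⟨γ (ι k), hγ _ ((hι k).mp k.2)⟩) :
    ∀ x : T.mu, 𝔉.psiAut Ψ β ((m.symm x : 𝔉.muTorsion 𝔉.BN 𝔉.N) : Aut 𝔉.BN) =
      ((m.symm (γΔ x) : 𝔉.muTorsion 𝔉.BN 𝔉.N) : Aut 𝔉.BN) := by
  intro x
  obtain ⟨k, hk, rfl⟩ := exists_eta_iota_eq_of_lDeltaCovered_galois H T ι m hι hpin hKD hcov x
  -- the representative `k′ := ι⁻¹ γ ι k ∈ Π^tp_Ÿ` of the `θ`-translate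
  have hmem : ι.symm (γ (ι k)) ∈ 𝔉.PiYdd :=
    (hι _).mpr (by rw [MulEquiv.apply_symm_apply]; exact hγ _ ((hι k).mp k.2))
  obtain ⟨hθk, hΔk⟩ := hΔ (𝔉.ρ k) hk
  have hk' : 𝔉.ρ ((⟨ι.symm (γ (ι k)), hmem⟩ : 𝔉.PiYdd) : 𝔉.PiX) ∈ P.pre (𝔉.base.obj 𝔉.BN) := by
    change 𝔉.ρ (ι.symm (γ (ι k))) ∈ P.pre (𝔉.base.obj 𝔉.BN)
    rw [← hshadow k]
    exact hθk
  have hιk' : ι ((⟨ι.symm (γ (ι k)), hmem⟩ : 𝔉.PiYdd) : 𝔉.PiX) = γ (ι k) := MulEquiv.apply_symm_apply ι _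
  have ek : (⟨γ (ι k), hγ _ ((hι k).mp k.2)⟩ : T.PiYdd) =
      ⟨ι ((⟨ι.symm (γ (ι k)), hmem⟩ : 𝔉.PiYdd) : 𝔉.PiX), (hι _).mp hmem⟩ := Subtype.ext hιk'.symm
  have eg : (⟨θ (𝔉.ρ k), hθk⟩ : P.pre (𝔉.base.obj 𝔉.BN)) =
      ⟨𝔉.ρ ((⟨ι.symm (γ (ι k)), hmem⟩ : 𝔉.PiYdd) : 𝔉.PiX), hk'⟩ := Subtype.ext (hshadow k)
  rw [coe_symm_eta_eq_rigidity_galois H T ι m hι hpin hKD k hk, hK4β, hΔk, hγΔ k hk, ek,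
    coe_symm_eta_eq_rigidity_galois H T ι m hι hpin hKD ⟨ι.symm (γ (ι k)), hmem⟩ hk', eg]

/-- **The junction's `γ_Δ` EXISTS** (no choice left to R-C5): `γ_Δ := m ∘ ρ_{B_N} ∘ ((l·Δ_Θ) ⊗ ℤ/N)(β) ∘ aΨ_{B_N} ∘ ρ_{B_N}⁻¹ ∘ m⁻¹`
satisfies `hK4` (by (K4β) alone) AND (J2η) `γ_Δ(η(ι k)) = η(γ(ι k))` on the Δ-part (by (J1) pointwise, T56-L09c and the shadow law) —
abc-iut-w5-d034's «γ_Δ = θ′-conjugation on `(l·Δ_Θ)_{B_N} ⊗ ℤ/N` transported by `r`», now with its Δ-part description a theorem.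
[cite: MochizukiEtTh2009, Thm 5.7 proof p.330 (PDF p.104); Thm 5.6 p.329 (PDF p.103)] -/
theorem exists_gammaDelta_of_rigidity_galois (H : 𝔉.Facts) (T : ThetaEnvData.{v} 𝔉.N) (ι : 𝔉.PiX ≃* T.PiX)
    (m : 𝔉.muTorsion 𝔉.BN 𝔉.N ≃* T.mu) (hι : 𝔉.IdentifiesPiYdd T ι) {η : T.PiYdd → T.mu}
    (hpin : 𝔉.ThetaSectionCompat H T ι m hι η) {P : ThetaSubquotientProjGalois 𝔉 Gal} {ρ : RigidityFamily 𝔉}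
    {hB : 𝔉.IsThetaSaturated 𝔉.BN} (hKD : P.IsKummerDetermined ρ hB)
    (Ψ : C ≌ C) (β : Ψ.functor.obj 𝔉.BN ≅ 𝔉.BN)
    (aΨ : ∀ S : C, 𝔉.lDeltaModN S ≃* 𝔉.lDeltaModN (Ψ.functor.obj S))
    (θ : Aut (𝔉.base.obj 𝔉.BN) ≃* Aut (𝔉.base.obj 𝔉.BN)) (hΔ : Thm56Sub.DeltaTransportCompatGal 𝔉 Ψ β aΨ θ P)
    (hK4β : ∀ x : 𝔉.lDeltaModN 𝔉.BN, 𝔉.psiAut Ψ β (ρ 𝔉.BN hB x : Aut 𝔉.BN) =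
      (ρ 𝔉.BN hB (𝔉.lDeltaModNMap β.hom (aΨ 𝔉.BN x)) : Aut 𝔉.BN))
    (γ : T.PiX → T.PiX) (hγ : ∀ x : T.PiX, x ∈ T.PiYdd → γ x ∈ T.PiYdd)
    (hshadow : ∀ k : 𝔉.PiYdd, θ (𝔉.ρ k) = 𝔉.ρ (ι.symm (γ (ι k)))) :
    ∃ γΔ : T.mu → T.mu,
      (∀ x : T.mu, 𝔉.psiAut Ψ β ((m.symm x : 𝔉.muTorsion 𝔉.BN 𝔉.N) : Aut 𝔉.BN) =
        ((m.symm (γΔ x) : 𝔉.muTorsion 𝔉.BN 𝔉.N) : Aut 𝔉.BN)) ∧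
      (∀ k : 𝔉.PiYdd, 𝔉.ρ k ∈ P.pre (𝔉.base.obj 𝔉.BN) →
        γΔ (η ⟨ι k, (hι k).mp k.2⟩) = η ⟨γ (ι k), hγ _ ((hι k).mp k.2)⟩) := by
  refine ⟨fun x => m (ρ 𝔉.BN hB (𝔉.lDeltaModNMap β.hom (aΨ 𝔉.BN ((ρ 𝔉.BN hB).symm (m.symm x))))), ?_, ?_⟩
  · intro x
    rw [MulEquiv.symm_apply_apply, ← hK4β, MulEquiv.apply_symm_apply]
  · intro k hk
    have hmem : ι.symm (γ (ι k)) ∈ 𝔉.PiYdd :=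
      (hι _).mpr (by rw [MulEquiv.apply_symm_apply]; exact hγ _ ((hι k).mp k.2))
    obtain ⟨hθk, hΔk⟩ := hΔ (𝔉.ρ k) hk
    have hk' : 𝔉.ρ ((⟨ι.symm (γ (ι k)), hmem⟩ : 𝔉.PiYdd) : 𝔉.PiX) ∈ P.pre (𝔉.base.obj 𝔉.BN) := by
      change 𝔉.ρ (ι.symm (γ (ι k))) ∈ P.pre (𝔉.base.obj 𝔉.BN)
      rw [← hshadow k]
      exact hθk
    have hιk' : ι ((⟨ι.symm (γ (ι k)), hmem⟩ : 𝔉.PiYdd) : 𝔉.PiX) = γ (ι k) := MulEquiv.apply_symm_apply ι _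
    have ek : (⟨γ (ι k), hγ _ ((hι k).mp k.2)⟩ : T.PiYdd) =
        ⟨ι ((⟨ι.symm (γ (ι k)), hmem⟩ : 𝔉.PiYdd) : 𝔉.PiX), (hι _).mp hmem⟩ := Subtype.ext hιk'.symm
    have eg : (⟨θ (𝔉.ρ k), hθk⟩ : P.pre (𝔉.base.obj 𝔉.BN)) =
        ⟨𝔉.ρ ((⟨ι.symm (γ (ι k)), hmem⟩ : 𝔉.PiYdd) : 𝔉.PiX), hk'⟩ := Subtype.ext (hshadow k)
    change m (ρ 𝔉.BN hB (𝔉.lDeltaModNMap β.hom (aΨ 𝔉.BN ((ρ 𝔉.BN hB).symm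
      (m.symm (η ⟨ι k, (hι k).mp k.2⟩)))))) = η ⟨γ (ι k), hγ _ ((hι k).mp k.2)⟩
    rw [symm_eta_eq_rigidity_galois H T ι m hι hpin hKD k hk, MulEquiv.symm_apply_apply, hΔk, eg,
      ← symm_eta_eq_rigidity_galois H T ι m hι hpin hKD ⟨ι.symm (γ (ι k)), hmem⟩ hk', MulEquiv.apply_symm_apply, ek]

/-- **(J2η) DETERMINES `γ_Δ`**: two self-maps of `μ_N` that are `γ` on the theta classes of the Δ-part coincide (those classes exhaust
`μ_N`).  So «the `γ_Δ` for which R-C5 must prove `hC5`» is ONE well-defined map.  [cite: MochizukiEtTh2009, Thm 5.7 proof p.330 (PDF p.104)] -/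
theorem gammaDelta_unique_galois (H : 𝔉.Facts) (T : ThetaEnvData.{v} 𝔉.N) (ι : 𝔉.PiX ≃* T.PiX)
    (m : 𝔉.muTorsion 𝔉.BN 𝔉.N ≃* T.mu) (hι : 𝔉.IdentifiesPiYdd T ι) {η : T.PiYdd → T.mu}
    (hpin : 𝔉.ThetaSectionCompat H T ι m hι η) {P : ThetaSubquotientProjGalois 𝔉 Gal} {ρ : RigidityFamily 𝔉}
    {hB : 𝔉.IsThetaSaturated 𝔉.BN} (hKD : P.IsKummerDetermined ρ hB) (hcov : Thm56Sub.LDeltaCoveredGal 𝔉 P)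
    (γ : T.PiX → T.PiX) (hγ : ∀ x : T.PiX, x ∈ T.PiYdd → γ x ∈ T.PiYdd) {γΔ γΔ' : T.mu → T.mu}
    (hγΔ : ∀ k : 𝔉.PiYdd, 𝔉.ρ k ∈ P.pre (𝔉.base.obj 𝔉.BN) →
      γΔ (η ⟨ι k, (hι k).mp k.2⟩) = η ⟨γ (ι k), hγ _ ((hι k).mp k.2)⟩)
    (hγΔ' : ∀ k : 𝔉.PiYdd, 𝔉.ρ k ∈ P.pre (𝔉.base.obj 𝔉.BN) →
      γΔ' (η ⟨ι k, (hι k).mp k.2⟩) = η ⟨γ (ι k), hγ _ ((hι k).mp k.2)⟩) :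
    γΔ = γΔ' := by
  funext x
  obtain ⟨k, hk, rfl⟩ := exists_eta_iota_eq_of_lDeltaCovered_galois H T ι m hι hpin hKD hcov x
  rw [hγΔ k hk, hγΔ' k hk]

/-! ### (3) abc-iut-L2-d4's `HC` with the binder `hK4` replaced by the Thm. 5.6 package — on the v2 record -/

/-- **`HC` of Thm. 5.7 from the pin, Prop. 5.5 / Thm. 5.6 AS TYPED, and Cor. 2.8 (i)** — abc-iut-L2-d4's
`kummerComparison_of_thetaSectionCompat` (p453757) with `hK4` DISCHARGED by `psiAut_symm_eq_of_rigidity_galois`: the K4-side inputs are now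
`IsKummerDetermined P ρ hB`, `LDeltaCovered P`, `DeltaTransportCompat Ψ β aΨ θ P` and (K4β) — the conjuncts ∃-produced at the genuine
level-`N` data by abc-iut-w5-d034's `exists_rigidity_kummerComparisonInputs_levelN` (p450400) — and the R-C5-side inputs are (J2η), `hC5`,
`hκ` for the SAME `γ_Δ`.  Conclusion VERBATIM the `HC` consumed by `isFixed_discrepancy_of_kummerComparison` (p448195).
[cite: MochizukiEtTh2009, Thm 5.7 proof p.330 (PDF p.104); Thm 5.6 p.328 (PDF p.102); Prop 5.5 p.327 (PDF p.101); Cor 2.8 (i) p.268 (PDF p.42)] -/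
theorem kummerComparison_of_thetaSectionCompat_of_rigidity_galois (H : 𝔉.Facts) (T : ThetaEnvData.{v} 𝔉.N)
    (ι : 𝔉.PiX ≃* T.PiX) (m : 𝔉.muTorsion 𝔉.BN 𝔉.N ≃* T.mu) (hι : 𝔉.IdentifiesPiYdd T ι) {η : T.PiYdd → T.mu}
    (hpin : 𝔉.ThetaSectionCompat H T ι m hι η) {P : ThetaSubquotientProjGalois 𝔉 Gal} {ρ : RigidityFamily 𝔉}
    {hB : 𝔉.IsThetaSaturated 𝔉.BN} (hKD : P.IsKummerDetermined ρ hB) (hcov : Thm56Sub.LDeltaCoveredGal 𝔉 P)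
    (Ψ : C ≌ C) (β : Ψ.functor.obj 𝔉.BN ≅ 𝔉.BN)
    (aΨ : ∀ S : C, 𝔉.lDeltaModN S ≃* 𝔉.lDeltaModN (Ψ.functor.obj S))
    (θ : Aut (𝔉.base.obj 𝔉.BN) ≃* Aut (𝔉.base.obj 𝔉.BN)) (hYdd : 𝔉.HB.map θ.toMonoidHom = 𝔉.HB)
    (hΔ : Thm56Sub.DeltaTransportCompatGal 𝔉 Ψ β aΨ θ P)
    (hK4β : ∀ x : 𝔉.lDeltaModN 𝔉.BN, 𝔉.psiAut Ψ β (ρ 𝔉.BN hB x : Aut 𝔉.BN) =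
      (ρ 𝔉.BN hB (𝔉.lDeltaModNMap β.hom (aΨ 𝔉.BN x)) : Aut 𝔉.BN))
    (ξ : Aut 𝔉.BN) (γ : T.PiX → T.PiX) (hγ : ∀ x : T.PiX, x ∈ T.PiYdd → γ x ∈ T.PiYdd) (γΔ : T.mu → T.mu)
    (κ : T.PiYdd → T.mu) (hshadow : ∀ k : 𝔉.PiYdd, θ (𝔉.ρ k) = 𝔉.ρ (ι.symm (γ (ι k))))
    (hγΔ : ∀ k : 𝔉.PiYdd, 𝔉.ρ k ∈ P.pre (𝔉.base.obj 𝔉.BN) →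
      γΔ (η ⟨ι k, (hι k).mp k.2⟩) = η ⟨γ (ι k), hγ _ ((hι k).mp k.2)⟩)
    (hC5 : ∀ k : T.PiYdd, γΔ (η k) = η ⟨γ k, hγ k k.2⟩ * κ ⟨γ k, hγ k k.2⟩)
    (hκ : ∀ k : 𝔉.PiYdd, ((m.symm (κ ⟨ι k, (hι k).mp k.2⟩) : 𝔉.muTorsion 𝔉.BN 𝔉.N) : Aut 𝔉.BN) =
      𝔉.sgpCup (𝔉.rhoYdd k) * ξ * (𝔉.sgpCup (𝔉.rhoYdd k))⁻¹ * ξ⁻¹) :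
    ∀ h : 𝔉.HB,
      𝔉.psiAut Ψ β (𝔉.sgpCap (h : Aut (𝔉.base.obj 𝔉.BN)) * (𝔉.sgpCup h)⁻¹) =
        (𝔉.sgpCap (θ h) * (𝔉.sgpCup ⟨θ h, (mem_iff_of_map_equiv_eq hYdd _).mpr h.2⟩)⁻¹) *
          (𝔉.sgpCup ⟨θ h, (mem_iff_of_map_equiv_eq hYdd _).mpr h.2⟩ * ξ *
            (𝔉.sgpCup ⟨θ h, (mem_iff_of_map_equiv_eq hYdd _).mpr h.2⟩)⁻¹ * ξ⁻¹) :=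
  kummerComparison_of_thetaSectionCompat H T ι m hι hpin Ψ β θ hYdd ξ γ hγ γΔ κ hshadow
    (psiAut_symm_eq_of_rigidity_galois H T ι m hι hpin hKD hcov Ψ β aΨ θ hΔ hK4β γ hγ hshadow γΔ hγΔ) hC5 hκ

/-- **The same with (K4β) itself discharged by Thm. 5.6 AS TYPED** (abc-iut-w5-d034's
`Thm56Sub.psiAut_rigidity_eq_rigidity_transport_of_preserved`): inputs `UnitsPullSpec` (T56-L09d, a THEOREM at the model data —
abc-iut-L2-t9's `comp_eq_unitsPull_comp`), abc-iut-L2-t4's `CyclotomicRigidityPreserved Ψ ρ aΨ` (= [EtTh] Thm. 5.6, both clauses) and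
`IsFunctorialLinear ρ` (Prop. 5.5, functoriality clause).
[cite: MochizukiEtTh2009, Thm 5.7 proof p.330 (PDF p.104); Thm 5.6 p.328 (PDF p.102); Prop 5.5 p.327 (PDF p.101)] -/
theorem kummerComparison_of_thetaSectionCompat_of_preserved_galois (H : 𝔉.Facts) (T : ThetaEnvData.{v} 𝔉.N)
    (ι : 𝔉.PiX ≃* T.PiX) (m : 𝔉.muTorsion 𝔉.BN 𝔉.N ≃* T.mu) (hι : 𝔉.IdentifiesPiYdd T ι) {η : T.PiYdd → T.mu}
    (hpin : 𝔉.ThetaSectionCompat H T ι m hι η) {P : ThetaSubquotientProjGalois 𝔉 Gal} {ρ : RigidityFamily 𝔉}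
    {hB : 𝔉.IsThetaSaturated 𝔉.BN} (hKD : P.IsKummerDetermined ρ hB) (hρ : IsFunctorialLinear 𝔉 ρ)
    (hcov : Thm56Sub.LDeltaCoveredGal 𝔉 P) (hspec : Thm56Sub.UnitsPullSpec 𝔉)
    (Ψ : C ≌ C) (β : Ψ.functor.obj 𝔉.BN ≅ 𝔉.BN)
    (aΨ : ∀ S : C, 𝔉.lDeltaModN S ≃* 𝔉.lDeltaModN (Ψ.functor.obj S)) (hcr : CyclotomicRigidityPreserved 𝔉 Ψ ρ aΨ)
    (θ : Aut (𝔉.base.obj 𝔉.BN) ≃* Aut (𝔉.base.obj 𝔉.BN)) (hYdd : 𝔉.HB.map θ.toMonoidHom = 𝔉.HB)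
    (hΔ : Thm56Sub.DeltaTransportCompatGal 𝔉 Ψ β aΨ θ P)
    (ξ : Aut 𝔉.BN) (γ : T.PiX → T.PiX) (hγ : ∀ x : T.PiX, x ∈ T.PiYdd → γ x ∈ T.PiYdd) (γΔ : T.mu → T.mu)
    (κ : T.PiYdd → T.mu) (hshadow : ∀ k : 𝔉.PiYdd, θ (𝔉.ρ k) = 𝔉.ρ (ι.symm (γ (ι k))))
    (hγΔ : ∀ k : 𝔉.PiYdd, 𝔉.ρ k ∈ P.pre (𝔉.base.obj 𝔉.BN) →
      γΔ (η ⟨ι k, (hι k).mp k.2⟩) = η ⟨γ (ι k), hγ _ ((hι k).mp k.2)⟩)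
    (hC5 : ∀ k : T.PiYdd, γΔ (η k) = η ⟨γ k, hγ k k.2⟩ * κ ⟨γ k, hγ k k.2⟩)
    (hκ : ∀ k : 𝔉.PiYdd, ((m.symm (κ ⟨ι k, (hι k).mp k.2⟩) : 𝔉.muTorsion 𝔉.BN 𝔉.N) : Aut 𝔉.BN) =
      𝔉.sgpCup (𝔉.rhoYdd k) * ξ * (𝔉.sgpCup (𝔉.rhoYdd k))⁻¹ * ξ⁻¹) :
    ∀ h : 𝔉.HB,
      𝔉.psiAut Ψ β (𝔉.sgpCap (h : Aut (𝔉.base.obj 𝔉.BN)) * (𝔉.sgpCup h)⁻¹) =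
        (𝔉.sgpCap (θ h) * (𝔉.sgpCup ⟨θ h, (mem_iff_of_map_equiv_eq hYdd _).mpr h.2⟩)⁻¹) *
          (𝔉.sgpCup ⟨θ h, (mem_iff_of_map_equiv_eq hYdd _).mpr h.2⟩ * ξ *
            (𝔉.sgpCup ⟨θ h, (mem_iff_of_map_equiv_eq hYdd _).mpr h.2⟩)⁻¹ * ξ⁻¹) :=
  kummerComparison_of_thetaSectionCompat_of_rigidity_galois H T ι m hι hpin hKD hcov Ψ β aΨ θ hYdd hΔ
    (fun x => Thm56Sub.psiAut_rigidity_eq_rigidity_transport_of_preserved Ψ β hspec aΨ ρ hB hcr hρ x)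
    ξ γ hγ γΔ κ hshadow hγΔ hC5 hκ

/-! ### (4) the EXPLICIT conjugation `γ_Δ⁰` and «any (J2η)-`γ_Δ` IS `γ_Δ⁰`» — on the v2 record -/

/-- **`γ_Δ⁰` is `γ` on the theta classes of the Δ-part** ((J2η) for the explicit conjugation): under the pin, `IsKummerDetermined`, T56-L09c
`DeltaTransportCompat Ψ β aΨ θ P` and the shadow law, `γ_Δ⁰(η(ι k)) = η(γ(ι k))` whenever `ρ k ∈ P.pre` — the content of
`exists_gammaDelta_of_rigidity_galois` with its witness named.  [cite: MochizukiEtTh2009, Thm 5.7 proof p.330 (PDF p.104); Thm 5.6 proof p.329 (PDF p.103)] -/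
theorem conj_eta_of_rigidity_galois (H : 𝔉.Facts) (T : ThetaEnvData.{v} 𝔉.N) (ι : 𝔉.PiX ≃* T.PiX)
    (m : 𝔉.muTorsion 𝔉.BN 𝔉.N ≃* T.mu) (hι : 𝔉.IdentifiesPiYdd T ι) {η : T.PiYdd → T.mu}
    (hpin : 𝔉.ThetaSectionCompat H T ι m hι η) {P : ThetaSubquotientProjGalois 𝔉 Gal} {ρ : RigidityFamily 𝔉}
    {hB : 𝔉.IsThetaSaturated 𝔉.BN} (hKD : P.IsKummerDetermined ρ hB)
    (Ψ : C ≌ C) (β : Ψ.functor.obj 𝔉.BN ≅ 𝔉.BN)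
    (aΨ : ∀ S : C, 𝔉.lDeltaModN S ≃* 𝔉.lDeltaModN (Ψ.functor.obj S))
    (θ : Aut (𝔉.base.obj 𝔉.BN) ≃* Aut (𝔉.base.obj 𝔉.BN)) (hΔ : Thm56Sub.DeltaTransportCompatGal 𝔉 Ψ β aΨ θ P)
    (γ : T.PiX → T.PiX) (hγ : ∀ x : T.PiX, x ∈ T.PiYdd → γ x ∈ T.PiYdd)
    (hshadow : ∀ k : 𝔉.PiYdd, θ (𝔉.ρ k) = 𝔉.ρ (ι.symm (γ (ι k)))) (k : 𝔉.PiYdd)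
    (hk : 𝔉.ρ k ∈ P.pre (𝔉.base.obj 𝔉.BN)) :
    m (ρ 𝔉.BN hB (𝔉.lDeltaModNMap β.hom (aΨ 𝔉.BN ((ρ 𝔉.BN hB).symm (m.symm (η ⟨ι k, (hι k).mp k.2⟩)))))) =
      η ⟨γ (ι k), hγ _ ((hι k).mp k.2)⟩ := by
  have hmem : ι.symm (γ (ι k)) ∈ 𝔉.PiYdd :=
    (hι _).mpr (by rw [MulEquiv.apply_symm_apply]; exact hγ _ ((hι k).mp k.2))
  obtain ⟨hθk, hΔk⟩ := hΔ (𝔉.ρ k) hk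
  have hk' : 𝔉.ρ ((⟨ι.symm (γ (ι k)), hmem⟩ : 𝔉.PiYdd) : 𝔉.PiX) ∈ P.pre (𝔉.base.obj 𝔉.BN) := by
    change 𝔉.ρ (ι.symm (γ (ι k))) ∈ P.pre (𝔉.base.obj 𝔉.BN)
    rw [← hshadow k]
    exact hθk
  have hιk' : ι ((⟨ι.symm (γ (ι k)), hmem⟩ : 𝔉.PiYdd) : 𝔉.PiX) = γ (ι k) := MulEquiv.apply_symm_apply ι _
  have ek : (⟨γ (ι k), hγ _ ((hι k).mp k.2)⟩ : T.PiYdd) =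
      ⟨ι ((⟨ι.symm (γ (ι k)), hmem⟩ : 𝔉.PiYdd) : 𝔉.PiX), (hι _).mp hmem⟩ := Subtype.ext hιk'.symm
  have eg : (⟨θ (𝔉.ρ k), hθk⟩ : P.pre (𝔉.base.obj 𝔉.BN)) =
      ⟨𝔉.ρ ((⟨ι.symm (γ (ι k)), hmem⟩ : 𝔉.PiYdd) : 𝔉.PiX), hk'⟩ := Subtype.ext (hshadow k)
  rw [symm_eta_eq_rigidity_galois H T ι m hι hpin hKD k hk, MulEquiv.symm_apply_apply, hΔk, eg,
    ← symm_eta_eq_rigidity_galois H T ι m hι hpin hKD ⟨ι.symm (γ (ι k)), hmem⟩ hk', MulEquiv.apply_symm_apply, ek]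

/-- **Any `γ_Δ` that is `γ` on the theta classes of the Δ-part IS the conjugation `γ_Δ⁰`** (coverage + `gammaDelta_unique_galois`): so the `γ_Δ` the
(C)-chain composer feeds to `hC5` — whether abc-iut-w5-d034's explicit conjugation or the étale-side transport `φΛ` of the level-`N` descent
(my `gammaDelta_eta_levelStub_of_pin`, `Sec5Thm57JunctionJ2OfRigidData.lean`) — is ONE map: R-C5's target does not depend on the choice.
[cite: MochizukiEtTh2009, Thm 5.7 proof p.330 (PDF p.104)] -/
theorem gammaDelta_eq_conj_of_eta_galois (H : 𝔉.Facts) (T : ThetaEnvData.{v} 𝔉.N) (ι : 𝔉.PiX ≃* T.PiX)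
    (m : 𝔉.muTorsion 𝔉.BN 𝔉.N ≃* T.mu) (hι : 𝔉.IdentifiesPiYdd T ι) {η : T.PiYdd → T.mu}
    (hpin : 𝔉.ThetaSectionCompat H T ι m hι η) {P : ThetaSubquotientProjGalois 𝔉 Gal} {ρ : RigidityFamily 𝔉}
    {hB : 𝔉.IsThetaSaturated 𝔉.BN} (hKD : P.IsKummerDetermined ρ hB) (hcov : Thm56Sub.LDeltaCoveredGal 𝔉 P)
    (Ψ : C ≌ C) (β : Ψ.functor.obj 𝔉.BN ≅ 𝔉.BN)
    (aΨ : ∀ S : C, 𝔉.lDeltaModN S ≃* 𝔉.lDeltaModN (Ψ.functor.obj S))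
    (θ : Aut (𝔉.base.obj 𝔉.BN) ≃* Aut (𝔉.base.obj 𝔉.BN)) (hΔ : Thm56Sub.DeltaTransportCompatGal 𝔉 Ψ β aΨ θ P)
    (γ : T.PiX → T.PiX) (hγ : ∀ x : T.PiX, x ∈ T.PiYdd → γ x ∈ T.PiYdd)
    (hshadow : ∀ k : 𝔉.PiYdd, θ (𝔉.ρ k) = 𝔉.ρ (ι.symm (γ (ι k)))) (γΔ : T.mu → T.mu)
    (hγΔ : ∀ k : 𝔉.PiYdd, 𝔉.ρ k ∈ P.pre (𝔉.base.obj 𝔉.BN) →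
      γΔ (η ⟨ι k, (hι k).mp k.2⟩) = η ⟨γ (ι k), hγ _ ((hι k).mp k.2)⟩) :
    γΔ = fun x => m (ρ 𝔉.BN hB (𝔉.lDeltaModNMap β.hom (aΨ 𝔉.BN ((ρ 𝔉.BN hB).symm (m.symm x))))) :=
  gammaDelta_unique_galois H T ι m hι hpin hKD hcov γ hγ hγΔ
    (fun k hk => conj_eta_of_rigidity_galois H T ι m hι hpin hKD Ψ β aΨ θ hΔ γ hγ hshadow k hk)

/-- Hence **`hK4` for ANY (J2η)-`γ_Δ` by rewriting it to the conjugation** — the same conclusion as `psiAut_symm_eq_of_rigidity_galois`, second proof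
(bookkeeping check that the two routes agree).  [cite: MochizukiEtTh2009, Thm 5.7 proof p.330 (PDF p.104)] -/
theorem psiAut_symm_eq_of_rigidity_galois' (H : 𝔉.Facts) (T : ThetaEnvData.{v} 𝔉.N) (ι : 𝔉.PiX ≃* T.PiX)
    (m : 𝔉.muTorsion 𝔉.BN 𝔉.N ≃* T.mu) (hι : 𝔉.IdentifiesPiYdd T ι) {η : T.PiYdd → T.mu}
    (hpin : 𝔉.ThetaSectionCompat H T ι m hι η) {P : ThetaSubquotientProjGalois 𝔉 Gal} {ρ : RigidityFamily 𝔉}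
    {hB : 𝔉.IsThetaSaturated 𝔉.BN} (hKD : P.IsKummerDetermined ρ hB) (hcov : Thm56Sub.LDeltaCoveredGal 𝔉 P)
    (Ψ : C ≌ C) (β : Ψ.functor.obj 𝔉.BN ≅ 𝔉.BN)
    (aΨ : ∀ S : C, 𝔉.lDeltaModN S ≃* 𝔉.lDeltaModN (Ψ.functor.obj S))
    (θ : Aut (𝔉.base.obj 𝔉.BN) ≃* Aut (𝔉.base.obj 𝔉.BN)) (hΔ : Thm56Sub.DeltaTransportCompatGal 𝔉 Ψ β aΨ θ P)
    (hK4β : ∀ x : 𝔉.lDeltaModN 𝔉.BN, 𝔉.psiAut Ψ β (ρ 𝔉.BN hB x : Aut 𝔉.BN) =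
      (ρ 𝔉.BN hB (𝔉.lDeltaModNMap β.hom (aΨ 𝔉.BN x)) : Aut 𝔉.BN))
    (γ : T.PiX → T.PiX) (hγ : ∀ x : T.PiX, x ∈ T.PiYdd → γ x ∈ T.PiYdd)
    (hshadow : ∀ k : 𝔉.PiYdd, θ (𝔉.ρ k) = 𝔉.ρ (ι.symm (γ (ι k)))) (γΔ : T.mu → T.mu)
    (hγΔ : ∀ k : 𝔉.PiYdd, 𝔉.ρ k ∈ P.pre (𝔉.base.obj 𝔉.BN) →
      γΔ (η ⟨ι k, (hι k).mp k.2⟩) = η ⟨γ (ι k), hγ _ ((hι k).mp k.2)⟩) (x : T.mu) :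
    𝔉.psiAut Ψ β ((m.symm x : 𝔉.muTorsion 𝔉.BN 𝔉.N) : Aut 𝔉.BN) =
      ((m.symm (γΔ x) : 𝔉.muTorsion 𝔉.BN 𝔉.N) : Aut 𝔉.BN) := by
  rw [gammaDelta_eq_conj_of_eta_galois H T ι m hι hpin hKD hcov Ψ β aΨ θ hΔ γ hγ hshadow γΔ hγΔ]
  exact psiAut_symm_eq_conj T m Ψ β ρ hB aΨ hK4β x

/-! ### (5) Bookkeeping: the v1 heads ARE the `toGalois` instances of the v2 heads (any `Gal`) -/

/-- abc-iut-L2-t9's v1 head `kummerComparison_of_thetaSectionCompat_of_preserved` (abc-iut-L2-d4's `HC` ⟸ pin + Prop. 5.5 +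
Thm. 5.6 AS TYPED) is the instance of `kummerComparison_of_thetaSectionCompat_of_preserved_galois` at the forgotten record
`P.toGalois Gal` — the v2 clauses on `P.toGalois Gal` ARE the v1 clauses (`Iff.rfl`, abc-iut-w6-d079 p481123 / p484491); the other eleven
heads un-port the same way.
[cite: MochizukiEtTh2009, Thm 5.7 proof p.330 (PDF p.104); Thm 5.6 p.328 (PDF p.102); Prop 5.5 p.327 (PDF p.101)] -/
theorem kummerComparison_of_thetaSectionCompat_of_preserved_of_toGalois (Gal : D → Prop) (H : 𝔉.Facts)
    (T : ThetaEnvData.{v} 𝔉.N) (ι : 𝔉.PiX ≃* T.PiX) (m : 𝔉.muTorsion 𝔉.BN 𝔉.N ≃* T.mu) (hι : 𝔉.IdentifiesPiYdd T ι)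
    {η : T.PiYdd → T.mu} (hpin : 𝔉.ThetaSectionCompat H T ι m hι η) {P : ThetaSubquotientProj 𝔉} {ρ : RigidityFamily 𝔉}
    {hB : 𝔉.IsThetaSaturated 𝔉.BN} (hKD : IsKummerDetermined 𝔉 P ρ hB) (hρ : IsFunctorialLinear 𝔉 ρ)
    (hcov : Thm56Sub.LDeltaCovered 𝔉 P) (hspec : Thm56Sub.UnitsPullSpec 𝔉)
    (Ψ : C ≌ C) (β : Ψ.functor.obj 𝔉.BN ≅ 𝔉.BN)
    (aΨ : ∀ S : C, 𝔉.lDeltaModN S ≃* 𝔉.lDeltaModN (Ψ.functor.obj S)) (hcr : CyclotomicRigidityPreserved 𝔉 Ψ ρ aΨ)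
    (θ : Aut (𝔉.base.obj 𝔉.BN) ≃* Aut (𝔉.base.obj 𝔉.BN)) (hYdd : 𝔉.HB.map θ.toMonoidHom = 𝔉.HB)
    (hΔ : Thm56Sub.DeltaTransportCompat 𝔉 Ψ β aΨ θ P)
    (ξ : Aut 𝔉.BN) (γ : T.PiX → T.PiX) (hγ : ∀ x : T.PiX, x ∈ T.PiYdd → γ x ∈ T.PiYdd) (γΔ : T.mu → T.mu)
    (κ : T.PiYdd → T.mu) (hshadow : ∀ k : 𝔉.PiYdd, θ (𝔉.ρ k) = 𝔉.ρ (ι.symm (γ (ι k))))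
    (hγΔ : ∀ k : 𝔉.PiYdd, 𝔉.ρ k ∈ P.pre (𝔉.base.obj 𝔉.BN) →
      γΔ (η ⟨ι k, (hι k).mp k.2⟩) = η ⟨γ (ι k), hγ _ ((hι k).mp k.2)⟩)
    (hC5 : ∀ k : T.PiYdd, γΔ (η k) = η ⟨γ k, hγ k k.2⟩ * κ ⟨γ k, hγ k k.2⟩)
    (hκ : ∀ k : 𝔉.PiYdd, ((m.symm (κ ⟨ι k, (hι k).mp k.2⟩) : 𝔉.muTorsion 𝔉.BN 𝔉.N) : Aut 𝔉.BN) =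
      𝔉.sgpCup (𝔉.rhoYdd k) * ξ * (𝔉.sgpCup (𝔉.rhoYdd k))⁻¹ * ξ⁻¹) :
    ∀ h : 𝔉.HB,
      𝔉.psiAut Ψ β (𝔉.sgpCap (h : Aut (𝔉.base.obj 𝔉.BN)) * (𝔉.sgpCup h)⁻¹) =
        (𝔉.sgpCap (θ h) * (𝔉.sgpCup ⟨θ h, (mem_iff_of_map_equiv_eq hYdd _).mpr h.2⟩)⁻¹) *
          (𝔉.sgpCup ⟨θ h, (mem_iff_of_map_equiv_eq hYdd _).mpr h.2⟩ * ξ *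
            (𝔉.sgpCup ⟨θ h, (mem_iff_of_map_equiv_eq hYdd _).mpr h.2⟩)⁻¹ * ξ⁻¹) :=
  kummerComparison_of_thetaSectionCompat_of_preserved_galois (P := P.toGalois Gal) H T ι m hι hpin
    ((ThetaSubquotientProjGalois.isKummerDetermined_toGalois_iff Gal P ρ hB).mpr hKD) hρ
    ((Thm56Sub.lDeltaCoveredGal_toGalois_iff 𝔉 Gal P).mpr hcov) hspec Ψ β aΨ hcr θ hYdd
    ((Thm56Sub.deltaTransportCompatGal_toGalois_iff 𝔉 Gal Ψ β aΨ θ P).mpr hΔ) ξ γ hγ γΔ κ hshadow hγΔ hC5 hκ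

end ThetaFrobenioid

end Literature.AnabelianGeometry.EtaleTheta
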